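import Literature.MathematicalPhysics.QuantumLattice.HubbardNNNHoppingParticleHole
import Summits.HubbardSuperconductivity.HubbardSuperconductivity.Theorems.SoloBlindParticleHoleSectors
import Literature.MathematicalPhysics.QuantumLattice.SusyTJLadderBookkeeping
import HarnessLib

/-!
# Particle–hole pairs `P H Pᴴ = H' - U N + c`: sectors, ground states, correlators

HONEST FRAMING: ladder R1–R4 with certified numbers; no claim on H/H₀. This file is part 1 of the
exact SYMMETRY DICTIONARY of the pair channel (pub-hubbard r3); it certifies no number and reaches
no rung.

Setting: a finite set of sites `Λ`, Lieb's particle–hole unitary `P = particleHole ε` with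
unimodular phases `ε`, and two operators with `P H Pᴴ = H' - U N + c` (the tree's
`hamiltonian_particleHole_bipartite`, `hamiltonian_particleHole_sameSign` and their sums produce
exactly this shape; on the even torus `H = H(t,t',U)`, `H' = H(t,-t',U)`, `c = U L²`). Recorded:

* §1 `Pᴴ` carries unit ground states of `H'` among `N`-particle vectors (`IsGroundState`), resp. in
  the joint sector `(N, S^z = M)` (`IsGroundStateInSector`), to unit ground states of `H` among
  `(2|Λ| - N)`-particle vectors, resp. in `(2|Λ| - N, S^z = -M)`; the sector energies shift by
  `c - U N` (`minEnergyOn_szSector_of_conj`; no Hermiticity needed). This extends the tree's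
  `ParticleHole.isGroundStateInSector_conjTranspose_mulVec` (pure Hubbard `hamiltonian G t U`) to
  conjugation PAIRS, which is what a next-nearest-neighbour hopping `t' ≠ 0` requires.
* §2 (CAR, any mode set) a product of two annihilators commutes with creators at other modes;
  `⟨ψ, Aᴴψ⟩ = conj ⟨ψ, Aψ⟩`; and for operators with `P A Pᴴ = Aᴴ`, `P B Pᴴ = Bᴴ`, `[A, Bᴴ] = 0`:
  `⟨Pᴴψ, Aᴴ B Pᴴψ⟩ = ⟨ψ, Bᴴ A ψ⟩` (`expect_conjTranspose_mulVec_of_conj`).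

Elementary. Lieb, PRL 62 (1989) 1201; Lieb–Wu, Physica A 321 (2003) 1, §1 eq. (3); Essler et al.
(2005) §2.2.4. [cite: LiebWuPhysicaA2003, §1 eq. (3)] [cite: EsslerEtAl2005, §2.2.4]
-/

noncomputable section

namespace Summit.HubbardSuperconductivity.HubbardLadder

open Matrix Literature.Probability.LatticeModels Literature.MathematicalPhysics.QuantumLattice
  HubbardWave0 Summit.HubbardSuperconductivity.HubbardSuperconductivity.Theorems
open scoped ComplexOrder ComplexConjugate

namespace PairChannelParticleHole

/-! ## §1 Ground states under a particle–hole pair `P H Pᴴ = H' - U N + c` -/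

section General

variable {Λ : Type*} [LinearOrder Λ] [Fintype Λ]

/-- `H (Pᴴψ) = Pᴴ (H'ψ) + (c - U N) Pᴴψ` on `N`-particle vectors, for unimodular phases and
`P H Pᴴ = H' - U N + c`. [cite: LiebWuPhysicaA2003, §1 eq. (3)] -/
theorem mulVec_conjTranspose_mulVec_of_conj (ε : Orb Λ → ℂ) (hε : ∀ i, ‖ε i‖ = 1)
    {H H' : Matrix (Finset (Orb Λ)) (Finset (Orb Λ)) ℂ} {U c : ℝ}
    (hconj : particleHole ε * H * (particleHole ε)ᴴ =
      H' - (U : ℂ) • totalNumber + (c : ℂ) • (1 : Matrix (Finset (Orb Λ)) (Finset (Orb Λ)) ℂ))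
    {N : ℕ} {ψ : Fock (Orb Λ)} (hψ : IsNParticle N ψ) :
    H *ᵥ ((particleHole ε)ᴴ *ᵥ ψ) =
      (particleHole ε)ᴴ *ᵥ (H' *ᵥ ψ) + ((c - U * N : ℝ) : ℂ) • ((particleHole ε)ᴴ *ᵥ ψ) := by
  have hHP : H * (particleHole ε)ᴴ =
      (particleHole ε)ᴴ * (H' - (U : ℂ) • totalNumber + (c : ℂ) • 1) := by
    rw [← hconj, ← Matrix.mul_assoc, ← Matrix.mul_assoc, particleHole_conjTranspose_mul ε hε,
      Matrix.one_mul]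
  rw [mulVec_mulVec, hHP, ← mulVec_mulVec, add_mulVec, sub_mulVec, smul_mulVec, smul_mulVec,
    one_mulVec, totalNumber_mulVec_of_isNParticle hψ, mulVec_add, mulVec_sub, mulVec_smul,
    mulVec_smul, mulVec_smul, smul_smul]
  have hc : ((c - U * N : ℝ) : ℂ) = (c : ℂ) - (U : ℂ) * (N : ℂ) := by push_cast; ring
  rw [hc, sub_smul]
  abel

/-- Rayleigh quotients: `re ⟨Pᴴψ, H Pᴴψ⟩ = re ⟨ψ, H'ψ⟩ + (c - U N)` for unit `N`-particle `ψ`.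
[cite: LiebWuPhysicaA2003, §1 eq. (3)] -/
theorem re_expect_conjTranspose_mulVec_of_conj (ε : Orb Λ → ℂ) (hε : ∀ i, ‖ε i‖ = 1)
    {H H' : Matrix (Finset (Orb Λ)) (Finset (Orb Λ)) ℂ} {U c : ℝ}
    (hconj : particleHole ε * H * (particleHole ε)ᴴ =
      H' - (U : ℂ) • totalNumber + (c : ℂ) • (1 : Matrix (Finset (Orb Λ)) (Finset (Orb Λ)) ℂ))
    {N : ℕ} {ψ : Fock (Orb Λ)} (hψ : IsNParticle N ψ) (h1 : star ψ ⬝ᵥ ψ = 1) :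
    (star ((particleHole ε)ᴴ *ᵥ ψ) ⬝ᵥ H *ᵥ ((particleHole ε)ᴴ *ᵥ ψ)).re =
      (star ψ ⬝ᵥ H' *ᵥ ψ).re + (c - U * N) := by
  rw [mulVec_conjTranspose_mulVec_of_conj ε hε hconj hψ, dotProduct_add, dotProduct_smul,
    ParticleHole.star_conjTranspose_mulVec_dotProduct ε hε,
    ParticleHole.star_conjTranspose_mulVec_dotProduct ε hε, h1, smul_eq_mul, mul_one,
    Complex.add_re, Complex.ofReal_re]

/-- `P` maps the joint sector `(N, S^z = M)` into `(2|Λ| - N, S^z = -M)` (companion of the tree's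
`ParticleHole.conjTranspose_mulVec_mem_szSector`, which is the statement for `Pᴴ`).
[cite: LiebPRL1989, Remark (2)] -/
theorem mulVec_mem_szSector (ε : Orb Λ → ℂ) (hε : ∀ i, ‖ε i‖ = 1) {N : ℕ} {M : ℝ}
    {ψ : Fock (Orb Λ)} (hψ : ψ ∈ szSector N M) :
    particleHole ε *ᵥ ψ ∈ szSector (2 * Fintype.card Λ - N) (-M) := by
  rw [mem_szSector_iff] at hψ ⊢
  obtain ⟨hN, hS⟩ := hψ
  refine ⟨?_, ?_⟩
  · intro s hs
    rw [particleHole_mulVec_apply]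
    have hc : sᶜ.card ≠ N := by
      rw [Finset.card_compl, card_orb]
      have := s.card_le_univ
      rw [card_orb] at this
      omega
    rw [hN _ hc, mul_zero]
  · have h := congrArg (· * particleHole ε)
      (ParticleHole.particleHole_mul_spinZ_mul_conjTranspose ε hε)
    simp only [Matrix.mul_assoc, particleHole_conjTranspose_mul ε hε, Matrix.mul_one,
      Matrix.neg_mul] at h
    have hcomm : HubbardWave0.spinZ * particleHole ε = -(particleHole ε * HubbardWave0.spinZ) := by
      rw [h, neg_neg]
    rw [mulVec_mulVec, hcomm, Matrix.neg_mulVec, ← mulVec_mulVec, hS, mulVec_smul,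
      Complex.ofReal_neg, neg_smul]

/-- **Sector energies under the pair `P H Pᴴ = H' - U N + c`:**
`λ_min^H(2|Λ| - N, -M) = λ_min^{H'}(N, M) + (c - U N)` whenever the sector `(N, M)` contains a unit
vector. No Hermiticity is needed: both sides are infima of real parts of Rayleigh quotients over
sets of unit vectors matched by the unitary `P`. [cite: LiebWuPhysicaA2003, §1 eq. (3)] -/
theorem minEnergyOn_szSector_of_conj (ε : Orb Λ → ℂ) (hε : ∀ i, ‖ε i‖ = 1)
    {H H' : Matrix (Finset (Orb Λ)) (Finset (Orb Λ)) ℂ} {U c : ℝ}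
    (hconj : particleHole ε * H * (particleHole ε)ᴴ =
      H' - (U : ℂ) • totalNumber + (c : ℂ) • (1 : Matrix (Finset (Orb Λ)) (Finset (Orb Λ)) ℂ))
    {N : ℕ} (hN : N ≤ 2 * Fintype.card Λ) (M : ℝ)
    (hne : ∃ φ ∈ szSector (Λ := Λ) N M, star φ ⬝ᵥ φ = 1) :
    H.minEnergyOn (szSector (2 * Fintype.card Λ - N) (-M)) =
      H'.minEnergyOn (szSector N M) + (c - U * N) := by
  set d : ℝ := c - U * N with hd
  set S : Set ℝ := {E : ℝ | ∃ ψ ∈ szSector (Λ := Λ) N M,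
      star ψ ⬝ᵥ ψ = 1 ∧ E = (star ψ ⬝ᵥ H' *ᵥ ψ).re} with hS
  set S' : Set ℝ := {E : ℝ | ∃ ψ ∈ szSector (Λ := Λ) (2 * Fintype.card Λ - N) (-M),
      star ψ ⬝ᵥ ψ = 1 ∧ E = (star ψ ⬝ᵥ H *ᵥ ψ).re} with hS'
  have hset : S' = (OrderIso.addRight d) '' S := by
    ext E
    simp only [hS, hS', Set.mem_image, OrderIso.addRight_apply, Set.mem_setOf_eq]
    constructor
    · rintro ⟨φ, hφ, h1, rfl⟩
      have hmem := mulVec_mem_szSector ε hε hφ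
      rw [show 2 * Fintype.card Λ - (2 * Fintype.card Λ - N) = N by omega, neg_neg] at hmem
      have hψN : IsNParticle N (particleHole ε *ᵥ φ) := ((mem_szSector_iff _ _ _).1 hmem).1
      have hψ1 : star (particleHole ε *ᵥ φ) ⬝ᵥ (particleHole ε *ᵥ φ) = 1 := by
        rw [star_mulVec, ← dotProduct_mulVec, mulVec_mulVec, particleHole_conjTranspose_mul ε hε,
          one_mulVec, h1]
      have hback : (particleHole ε)ᴴ *ᵥ (particleHole ε *ᵥ φ) = φ := by
        rw [mulVec_mulVec, particleHole_conjTranspose_mul ε hε, one_mulVec]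
      have h := re_expect_conjTranspose_mulVec_of_conj ε hε hconj hψN hψ1
      rw [hback] at h
      exact ⟨_, ⟨_, hmem, hψ1, rfl⟩, by rw [h, hd]⟩
    · rintro ⟨E, ⟨ψ, hψ, h1, rfl⟩, rfl⟩
      have hψN : IsNParticle N ψ := ((mem_szSector_iff _ _ _).1 hψ).1
      exact ⟨_, ParticleHole.conjTranspose_mulVec_mem_szSector ε hε hψ,
        by rw [ParticleHole.star_conjTranspose_mulVec_dotProduct ε hε, h1],
        by rw [re_expect_conjTranspose_mulVec_of_conj ε hε hconj hψN h1, hd]⟩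
  have hSne : S.Nonempty := by
    obtain ⟨φ, hφ, h1⟩ := hne
    exact ⟨_, φ, hφ, h1, rfl⟩
  have hbdd : BddBelow S := by
    refine ⟨-(∑ s, ∑ t, ‖H' s t‖), ?_⟩
    rintro E ⟨φ, -, h1, rfl⟩
    exact neg_sum_norm_le_re_expect H' h1
  unfold Matrix.minEnergyOn
  change sInf S' = sInf S + d
  rw [hset, ← OrderIso.map_csInf' _ hSne hbdd, OrderIso.addRight_apply]

/-- **Joint-sector ground states under the pair `P H Pᴴ = H' - U N + c`.** If `ψ` is a unit
ground state of `H'` in the sector `(N, S^z = M)` (`N ≤ 2|Λ|`), then `Pᴴψ` is a unit ground state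
of `H` in the sector `(2|Λ| - N, S^z = -M)`. [cite: LiebWuPhysicaA2003, §1 eq. (3)] -/
theorem isGroundStateInSector_conjTranspose_mulVec_of_conj (ε : Orb Λ → ℂ) (hε : ∀ i, ‖ε i‖ = 1)
    {H H' : Matrix (Finset (Orb Λ)) (Finset (Orb Λ)) ℂ} {U c : ℝ}
    (hconj : particleHole ε * H * (particleHole ε)ᴴ =
      H' - (U : ℂ) • totalNumber + (c : ℂ) • (1 : Matrix (Finset (Orb Λ)) (Finset (Orb Λ)) ℂ))
    {N : ℕ} (hN : N ≤ 2 * Fintype.card Λ) {M : ℝ} {ψ : Fock (Orb Λ)}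
    (hψ : IsGroundStateInSector H' N M ψ) (h1 : star ψ ⬝ᵥ ψ = 1) :
    IsGroundStateInSector H (2 * Fintype.card Λ - N) (-M) ((particleHole ε)ᴴ *ᵥ ψ) := by
  obtain ⟨hmem, hne0, heig⟩ := hψ
  have hψN : IsNParticle N ψ := ((mem_szSector_iff _ _ _).1 hmem).1
  refine ⟨ParticleHole.conjTranspose_mulVec_mem_szSector ε hε hmem, ?_, ?_⟩
  · intro h0
    have h := ParticleHole.star_conjTranspose_mulVec_dotProduct ε hε ψ ψ
    rw [h0, h1, dotProduct_zero] at h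
    exact zero_ne_one h
  · rw [mulVec_conjTranspose_mulVec_of_conj ε hε hconj hψN, heig, mulVec_smul, ← add_smul,
      ← Complex.ofReal_add, minEnergyOn_szSector_of_conj ε hε hconj hN M ⟨ψ, hmem, h1⟩]

/-- **`N`-sector ground states under the pair `P H Pᴴ = H' - U N + c`** (all `S^z`). If `ψ` is a
unit ground state of `H'` among `N`-particle vectors (`IsGroundState`, `N ≤ 2|Λ|`), then `Pᴴψ` is a
unit ground state of `H` among `(2|Λ| - N)`-particle vectors; the energies are related by the tree's
`groundEnergy_particleHole_transfer`. [cite: LiebWuPhysicaA2003, §1 eq. (3)] -/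
theorem isGroundState_conjTranspose_mulVec_of_conj (ε : Orb Λ → ℂ) (hε : ∀ i, ‖ε i‖ = 1)
    {H H' : Matrix (Finset (Orb Λ)) (Finset (Orb Λ)) ℂ} {U c : ℝ}
    (hconj : particleHole ε * H * (particleHole ε)ᴴ =
      H' - (U : ℂ) • totalNumber + (c : ℂ) • (1 : Matrix (Finset (Orb Λ)) (Finset (Orb Λ)) ℂ))
    {N : ℕ} (hN : N ≤ 2 * Fintype.card Λ) {ψ : Fock (Orb Λ)}
    (hψ : IsGroundState H' N ψ) (h1 : star ψ ⬝ᵥ ψ = 1) :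
    IsGroundState H (2 * Fintype.card Λ - N) ((particleHole ε)ᴴ *ᵥ ψ) := by
  obtain ⟨hψN, hne0, heig⟩ := hψ
  refine ⟨?_, ?_, ?_⟩
  · intro s hs
    rw [particleHole_conjTranspose_mulVec_apply]
    have hc : sᶜ.card ≠ N := by
      rw [Finset.card_compl, card_orb]
      have := s.card_le_univ
      rw [card_orb] at this
      omega
    rw [hψN _ hc, mul_zero]
  · intro h0
    have h := ParticleHole.star_conjTranspose_mulVec_dotProduct ε hε ψ ψ
    rw [h0, h1, dotProduct_zero] at h
    exact zero_ne_one h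
  · rw [mulVec_conjTranspose_mulVec_of_conj ε hε hconj hψN, heig, mulVec_smul, ← add_smul,
      ← Complex.ofReal_add, groundEnergy_particleHole_transfer ε hε hconj hN,
      show groundEnergy H' N + (c - U * N) = groundEnergy H' N - U * N + c by ring]

end General

/-! ## §2 CAR: pair annihilators commute with creators elsewhere; correlators of conjugates -/

section CAR

variable {ι : Type*} [LinearOrder ι] [Fintype ι]

/-- `c_a c†_c = -c†_c c_a` for distinct modes (CAR); the landed twin
`Literature.MathematicalPhysics.QuantumLattice.SusyTJ.annihilation_mul_creation_of_ne`
re-exported by name (filer edit, `dedup.landed`). [cite: EsslerEtAl2005, §2.1 eq. (2.2)] -/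
alias annihilation_mul_creation_of_ne :=
  Literature.MathematicalPhysics.QuantumLattice.SusyTJ.annihilation_mul_creation_of_ne

/-- A product of two annihilators commutes with a creator at a third mode:
`(c_a c_b) c†_c = c†_c (c_a c_b)` for `c ∉ {a, b}` (two CAR sign flips).
[cite: EsslerEtAl2005, §2.1 eq. (2.2)] -/
theorem commute_annihilation_mul_annihilation_creation {a b c : ι} (ha : a ≠ c) (hb : b ≠ c) :
    Commute (annihilation a * annihilation b) (creation c) := by
  show annihilation a * annihilation b * creation c = creation c * (annihilation a * annihilation b)
  rw [Matrix.mul_assoc, annihilation_mul_creation_of_ne hb, Matrix.mul_neg, ← Matrix.mul_assoc,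
    annihilation_mul_creation_of_ne ha, Matrix.neg_mul, neg_neg, Matrix.mul_assoc]

/-- `(c_a c_b)` commutes with `(c†_c c†_d)` when `{a, b} ∩ {c, d} = ∅`.
[cite: EsslerEtAl2005, §2.1 eq. (2.2)] -/
theorem commute_pairAnnihilation_pairCreation {a b c d : ι} (hac : a ≠ c) (hbc : b ≠ c)
    (had : a ≠ d) (hbd : b ≠ d) :
    Commute (annihilation a * annihilation b) (creation c * creation d) :=
  (commute_annihilation_mul_annihilation_creation hac hbc).mul_right
    (commute_annihilation_mul_annihilation_creation had hbd)

omit [LinearOrder ι] in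
/-- `⟨ψ, Aᴴ ψ⟩ = conj ⟨ψ, A ψ⟩`. [cite: EsslerEtAl2005, §2.1] -/
theorem expect_conjTranspose_eq_star (A : Matrix (Finset ι) (Finset ι) ℂ) (ψ : Fock ι) :
    expect Aᴴ ψ = star (expect A ψ) := by
  unfold expect
  rw [star_dotProduct, star_mulVec, conjTranspose_conjTranspose, ← dotProduct_mulVec]

/-- `P` is an isometry: `⟨Pᴴψ, Pᴴφ⟩ = ⟨ψ, φ⟩` for unimodular phases, on any finite mode set (the
tree's `ParticleHole.star_conjTranspose_mulVec_dotProduct` is the same statement on `Orb Λ`).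
[cite: LiebPRL1989, Remark (2)] -/
theorem star_conjTranspose_mulVec_dotProduct (ε : ι → ℂ) (hε : ∀ i, ‖ε i‖ = 1) (ψ φ : Fock ι) :
    star ((particleHole ε)ᴴ *ᵥ ψ) ⬝ᵥ ((particleHole ε)ᴴ *ᵥ φ) = star ψ ⬝ᵥ φ := by
  rw [star_mulVec, conjTranspose_conjTranspose, ← dotProduct_mulVec, mulVec_mulVec,
    particleHole_mul_conjTranspose ε hε, one_mulVec]

/-- **Correlators of particle–hole conjugates.** For unimodular phases and operators with
`P A Pᴴ = Aᴴ`, `P B Pᴴ = Bᴴ` and `[A, Bᴴ] = 0`: `⟨Pᴴψ, Aᴴ B Pᴴψ⟩ = ⟨ψ, Bᴴ A ψ⟩`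
(`Aᴴ B Pᴴ = Pᴴ (A Bᴴ)`, `P` is an isometry, then commute). [cite: Scalapino1995, §2] -/
theorem expect_conjTranspose_mulVec_of_conj (ε : ι → ℂ) (hε : ∀ i, ‖ε i‖ = 1)
    {A B : Matrix (Finset ι) (Finset ι) ℂ} (hA : particleHole ε * A * (particleHole ε)ᴴ = Aᴴ)
    (hB : particleHole ε * B * (particleHole ε)ᴴ = Bᴴ) (hAB : Commute A Bᴴ) (ψ : Fock ι) :
    expect (Aᴴ * B) ((particleHole ε)ᴴ *ᵥ ψ) = expect (Bᴴ * A) ψ := by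
  have hA' : particleHole ε * Aᴴ * (particleHole ε)ᴴ = A := by
    have h := congrArg conjTranspose hA
    rwa [conjTranspose_mul, conjTranspose_mul, conjTranspose_conjTranspose,
      conjTranspose_conjTranspose, ← Matrix.mul_assoc] at h
  have hkey : Aᴴ * B * (particleHole ε)ᴴ = (particleHole ε)ᴴ * (A * Bᴴ) := by
    calc Aᴴ * B * (particleHole ε)ᴴ
        = (particleHole ε)ᴴ * (particleHole ε * Aᴴ * (particleHole ε)ᴴ) *
            (particleHole ε * B * (particleHole ε)ᴴ) := by
          simp only [Matrix.mul_assoc]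
          rw [← Matrix.mul_assoc (particleHole ε)ᴴ (particleHole ε),
            particleHole_conjTranspose_mul ε hε, Matrix.one_mul,
            ← Matrix.mul_assoc (particleHole ε)ᴴ (particleHole ε),
            particleHole_conjTranspose_mul ε hε, Matrix.one_mul]
      _ = (particleHole ε)ᴴ * (A * Bᴴ) := by rw [hA', hB, Matrix.mul_assoc]
  have hv : (Aᴴ * B) *ᵥ ((particleHole ε)ᴴ *ᵥ ψ) = (particleHole ε)ᴴ *ᵥ ((A * Bᴴ) *ᵥ ψ) := by
    rw [mulVec_mulVec, mulVec_mulVec, hkey]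
  unfold expect
  rw [hv, star_conjTranspose_mulVec_dotProduct ε hε, hAB.eq]

end CAR

end PairChannelParticleHole

end Summit.HubbardSuperconductivity.HubbardLadder

end
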